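import Summits.AtomisticToContinuum.FouriersLaw.Theses.OddSectorIrreversibility
import Summits.AtomisticToContinuum.FouriersLaw.Theses.TransferKernelPositivity
import Summits.AtomisticToContinuum.FouriersLaw.Theses.LocalOhmBV
import Summits.AtomisticToContinuum.FouriersLaw.Theses.MatthiessenLadder
import Summits.AtomisticToContinuum.FouriersLaw.Theses.FeketeSeriesLaw
import Summits.AtomisticToContinuum.FouriersLaw.Theses.JunctionLocality
import Summits.AtomisticToContinuum.FouriersLaw.Theorems.BoundedResponseConverges.Negative.LoadBearing

/-!
# Line `two-scale-gluing-log-rigidity` — skeleton for crux `OddSectorIrreversibility.BoundedResponseConverges`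
(item stmt-AtomisticToContinuum-9141; crux-plan of idea card
`Cruxes/BoundedResponseConverges/Ideas/two-scale-gluing-log-rigidity.md`, triage r1-1/2/3: pass/pass/pass)

THE CRUX (import slot shared verbatim by `TransferKernelPositivity`, `LocalOhmBV`, `MatthiessenLadder`;
Disproof §twins `*_twin_iff : … ↔ … := Iff.rfl`): for `pinnedChain ω₂ lam β γ` (all `> 0`), under
weak-NESS uniqueness, along every steady family, at every `T > 0`: if the response coefficients
`D N = lim_{δ→0, δ≠0} totalCurrent(μ N (T+δ/2) (T−δ/2))/δ` exist and `(|D N|)` is bounded, then `D N → k > 0`.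
Notation: `R_N := (N − 1)/D_N` = bath-to-bath linear-response RESISTANCE (conductance `G_N = D_N/(N−1)`),
`r_N := R_{N+1} − R_N` = resistance cost of one more bead, `S := sup_N D_N` (the crux's `BddAbove`).

THE LINE (card; sharpened by the panel). Two ONE-SIDED length-comparison laws on the GLUING side only,
plus fixed-`N` positivity, plus a pure real-analysis rigidity lemma that is NOT Fekete:
* `stub_positiveConductance` (P) — `D_N > 0` for `N ≥ 2` (fixed `N`; verbatim twin of the route item
  `FeketeSeriesLaw.PositiveConductance`, stmt-AtomisticToContinuum-11750; size M);
* `stub_upperIncrement` (U) — `∃ C N₀ ∀ N ≥ N₀, R_{N+1} ≤ R_N + C`: one more bead between the last bead and its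
  bath never adds more than `C` resistance (local, one-sided; size XL);
* `stub_selfSimilarGluing` (S23) — `∃ ε ↓, Σ_k ε(2^k) < ∞, ∃ N₀ ∀ N ≥ N₀, R_{2N} ≤ 2R_N + N ε(N) ∧
  R_{3N} ≤ 3R_N + N ε(N)`: gluing two, resp. three, copies of the `N`-chain end to end — the two
  reflection-symmetric SELF-SIMILAR concatenations — loses at most a SUB-EXTENSIVE (log-Dini) amount of
  conductance (global, one-sided; size XL; HARDEST).
COMPOSITION (sorry-free, `BoundedResponseConverges_of`): the crux's `S < ∞` turns (P)+(U) into the floor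
`D_N ≥ 1/(2·max(C⁺, R_{N₀}))` and the one-sided Tauberian modulus `D_N − D_{N+1} ≤ 2C⁺S²/N` ("slowly decreasing
in `log N`"), and turns (S23) into `D_{2N} ≥ D_N − S²ε(N)`, `D_{3N} ≥ D_N − S²ε(N)`; then
`Glue.logScaleRigidity` (PROVED below, incl. its number-theoretic input `Glue.logTwoLogThreeDense`:
`ℕ log 2 + ℕ log 3` is eventually `δ`-dense for every `δ`, since `log 3/log 2 ∉ ℚ`) gives `D_N → k`,
`k ≥ floor > 0`: from a near-maximiser every large `M` is reached by a `×2/×3` staircase (cost `≤ 2Σ_{2^k ≥ N*} S²ε(2^k) → 0`)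
followed by a climb of `≤ δ` in `log N` (cost `≤ 2C⁺S²(δ + 1/N*)`), so `liminf D ≥ limsup D`. Doubling alone cannot
do this (`D_N = 2 + sin(2π log₂ N)`); the second, multiplicatively independent scale is the point.

WHERE THE CRUX'S HYPOTHESES ARE USED (Disproof.lean v1.5 / `Negative/LoadBearing.lean`, honoured BY NAME):
`boundedResponseConverges_false_without_bddAbove_harmonic` (= `_false_without_BddAbove`): `BddAbove` is
consumed in `BoundedResponseConverges_of` at exactly two arithmetic steps (modulus; doubling/tripling
conversion) and NOT in any stub — (U),(S23) are TRUE at the harmonic corner `lam = β = 0` (`r_N → 0`,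
`R_{2N} − 2R_N → −1/fluxLimit`; `fluxCoeff_eq`, `tendsto_fluxCoeff`), where the conclusion fails only because
`S = ∞`. `boundedResponseConverges_false_without_unique_gamma_zero` / `not_convergesAlong_gibbsFamily` (`0 < k`
is contentful; `D ≡ 0` along the `γ = 0` Gibbs family): answered by (P), which is false for `D ≡ 0`, and by the
floor PRODUCED from (P)+(U). `boundedResponseConverges_skeleton_insulating` (`D = 1/N`): excluded by the floor;
`boundedResponseConverges_skeleton_oscillating` (`D = 2 + (−1)^N`): excluded by the modulus `D_N − D_{N+1} ≤ C/N`.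
Landed Negative lemmas (`Theorems/BoundedResponseConverges/Negative/{LoadBearing,OscillationExcluded,Scaling}`)
refute no instance of any stub here (all three stubs are `∃ C`/`∃ ε`-statements about the anharmonic chain at
`lam, β, γ > 0`; nothing instantiates the harmonic corner or `γ = 0`); `LoadBearing` is imported so this is
checked in the same environment.

TRIAGE SHARPENINGS ACTED ON: (r1-2) "positivity is RELOCATED, not free" — made formal:
`conductanceLowerBound_of_stubs : stub_positiveConductance → stub_upperIncrement → JunctionLocality.ConductanceLowerBound`
(stmt-11749) is PROVED below, so (P)+(U) carry exactly that open content and the card's "for free" is withdrawn;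
(r1-1/2/3) the ladder lever of `ohmic-floor-monotone-ladder` implies (U),(S23) — recorded at sequence level
(`increment_of_monotone`, `gluing_of_monotone`, proved); (r1-3) "overshoot `κ(1 + c/log N)` violates (S23)" —
re-derived: it does NOT (`R_{2N} − 2R_N ≈ 1/κ + 2c·log 2·N/(κ log²N)`, so `ε(2^k) ≍ 1/k²`, summable); every
eventually-monotone relaxation passes (S23) by telescoping; the stub's actual enemy is a log-scale OSCILLATION of
`D_N` with infinite variation along `2^k` (`2 + sin(log log N)`), recorded in the line card.

Registered stubs (3): `stub_positiveConductance`, `stub_upperIncrement`, `stub_selfSimilarGluing` — each a sorried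
theorem `Holds.stub_<name> : <full statement over tree declarations, crux prefix verbatim> := by sorry` (registered by
`ledger skeleton check` under the short name with THAT text as signature) plus the by-name handle
`def stub_<name> : Prop := type_of% Holds.stub_<name>` required of the hypotheses of `BoundedResponseConverges_of`
by the layer-invariant audit (device of `Lines/balanced-split-concavity-transfer.lean`; seats cannot apply `@[stub]`).
Skeleton theorem: `BoundedResponseConverges_of : stub_positiveConductance → stub_upperIncrement →
stub_selfSimilarGluing → OddSectorIrreversibility.BoundedResponseConverges` (sorry-free; axioms propext /
Classical.choice / Quot.sound); the three twins follow definitionally (`…_transferKernelPositivity_of`, `…_localOhmBV_of`,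
`…_matthiessenLadder_of`).
-/

noncomputable section

namespace Summit.AtomisticToContinuum.FouriersLaw.Cruxes.BoundedResponseConverges.TwoScaleGluingLogRigidity

open Filter Topology Finset

/-! ## Part I — the glue `LogScaleRigidity`, proved (pure real analysis; ideator 1's `GlueIdeator1.lean`,
re-homed under this line's namespace so the skeleton is self-contained) -/

namespace Glue

/-- Same statement as `Sketch.lean`'s `LogScaleRigidity`. -/
def LogScaleRigidity : Prop :=
  ∀ (d : ℕ → ℝ) (S C c : ℝ) (ε : ℕ → ℝ) (N₀ : ℕ), 0 < c →
    (∀ N : ℕ, N₀ ≤ N → c ≤ d N) → (∀ N : ℕ, d N ≤ S) →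
    (∀ N : ℕ, N₀ ≤ N → d N - d (N + 1) ≤ C / N) →
    Antitone ε → Summable (fun k : ℕ => ε (2 ^ k)) →
    (∀ N : ℕ, N₀ ≤ N → d N - ε N ≤ d (2 * N)) →
    (∀ N : ℕ, N₀ ≤ N → d N - ε N ≤ d (3 * N)) →
    ∃ k : ℝ, 0 < k ∧ Tendsto d atTop (𝓝 k)

/-- Same statement as `Sketch.lean`'s `LogTwoLogThreeDense`. -/
def LogTwoLogThreeDense : Prop :=
  ∀ δ : ℝ, 0 < δ → ∃ X₀ : ℝ, ∀ X : ℝ, X₀ ≤ X →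
    ∃ a b : ℕ, X - δ ≤ a * Real.log 2 + b * Real.log 3 ∧ a * Real.log 2 + b * Real.log 3 ≤ X

/-! ### L0: the slack is nonnegative -/

theorem eps_nonneg {ε : ℕ → ℝ} (hε : Antitone ε) (hsum : Summable (fun k : ℕ => ε (2 ^ k))) (n : ℕ) :
    0 ≤ ε n := by
  have h0 : Tendsto (fun k : ℕ => ε (2 ^ k)) atTop (𝓝 0) := hsum.tendsto_atTop_zero
  refine le_of_tendsto h0 ?_
  refine eventually_atTop.2 ⟨n, fun k hk => hε ?_⟩
  calc n ≤ 2 ^ n := (Nat.lt_two_pow_self).le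
    _ ≤ 2 ^ k := Nat.pow_le_pow_right (by norm_num) hk

/-! ### L1: slow decrease, summed -/

theorem slow_sum {d : ℕ → ℝ} {C : ℝ} {N₀ : ℕ} (hC : 0 ≤ C)
    (hslow : ∀ N : ℕ, N₀ ≤ N → d N - d (N + 1) ≤ C / N) {N : ℕ} (hN0 : N₀ ≤ N) (hN2 : 2 ≤ N) :
    ∀ M : ℕ, N ≤ M → d N - d M ≤ C * (Real.log ((M : ℝ) - 1) - Real.log ((N : ℝ) - 1)) := by
  refine Nat.le_induction ?_ ?_
  · simp
  · intro M hNM ih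
    have hM2 : (2 : ℝ) ≤ M := by exact_mod_cast hN2.trans hNM
    have hMpos : (0 : ℝ) < M := by linarith
    have hM1pos : (0 : ℝ) < (M : ℝ) - 1 := by linarith
    have hstep : d M - d (M + 1) ≤ C / M := hslow M (hN0.trans hNM)
    -- 1/M ≤ log M - log (M - 1)
    have hlog : Real.log (((M : ℝ) - 1) / M) ≤ ((M : ℝ) - 1) / M - 1 :=
      Real.log_le_sub_one_of_pos (div_pos hM1pos hMpos)
    have hdiv : Real.log (((M : ℝ) - 1) / M) = Real.log ((M : ℝ) - 1) - Real.log M :=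
      Real.log_div hM1pos.ne' hMpos.ne'
    have hinv : ((M : ℝ) - 1) / M - 1 = -(1 / M) := by field_simp; ring
    have hkey : C / M ≤ C * (Real.log (M : ℝ) - Real.log ((M : ℝ) - 1)) := by
      have : 1 / (M : ℝ) ≤ Real.log (M : ℝ) - Real.log ((M : ℝ) - 1) := by linarith
      calc C / M = C * (1 / M) := by ring
        _ ≤ C * (Real.log (M : ℝ) - Real.log ((M : ℝ) - 1)) := mul_le_mul_of_nonneg_left this hC
    have hcast : (((M + 1 : ℕ) : ℝ) - 1) = (M : ℝ) := by push_cast; ring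
    rw [hcast]
    calc d N - d (M + 1) = (d N - d M) + (d M - d (M + 1)) := by ring
      _ ≤ C * (Real.log ((M : ℝ) - 1) - Real.log ((N : ℝ) - 1)) + C / M := add_le_add ih hstep
      _ ≤ C * (Real.log ((M : ℝ) - 1) - Real.log ((N : ℝ) - 1))
          + C * (Real.log (M : ℝ) - Real.log ((M : ℝ) - 1)) := by linarith
      _ = C * (Real.log (M : ℝ) - Real.log ((N : ℝ) - 1)) := by ring

/-! ### L2: staircases -/

theorem stair2 {d ε : ℕ → ℝ} {N₀ : ℕ} (h2 : ∀ N : ℕ, N₀ ≤ N → d N - ε N ≤ d (2 * N)) {N : ℕ}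
    (hN : N₀ ≤ N) : ∀ a : ℕ, d N - ∑ i ∈ range a, ε (2 ^ i * N) ≤ d (2 ^ a * N) := by
  intro a
  induction a with
  | zero => simp
  | succ a ih =>
    have hle : N₀ ≤ 2 ^ a * N := hN.trans (Nat.le_mul_of_pos_left N (Nat.pos_of_ne_zero (by positivity)))
    have := h2 (2 ^ a * N) hle
    rw [sum_range_succ, pow_succ]
    have hmul : 2 ^ a * 2 * N = 2 * (2 ^ a * N) := by ring
    rw [hmul]
    linarith

theorem stair3 {d ε : ℕ → ℝ} {N₀ : ℕ} (h3 : ∀ N : ℕ, N₀ ≤ N → d N - ε N ≤ d (3 * N)) {P : ℕ}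
    (hP : N₀ ≤ P) : ∀ b : ℕ, d P - ∑ j ∈ range b, ε (3 ^ j * P) ≤ d (3 ^ b * P) := by
  intro b
  induction b with
  | zero => simp
  | succ b ih =>
    have hle : N₀ ≤ 3 ^ b * P := hP.trans (Nat.le_mul_of_pos_left P (Nat.pos_of_ne_zero (by positivity)))
    have := h3 (3 ^ b * P) hle
    rw [sum_range_succ, pow_succ]
    have hmul : 3 ^ b * 3 * P = 3 * (3 ^ b * P) := by ring
    rw [hmul]
    linarith

/-- Bounding a staircase sum by a dyadic tail: if every argument of the sum is `≥ 2^(i+L)` termwise,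
antitonicity moves the sum below the tail `∑' k, ε (2^(k+L))`. Shifted version (offset `a`). -/
theorem sum_le_tail {ε : ℕ → ℝ} (hε : Antitone ε) (hsum : Summable (fun k : ℕ => ε (2 ^ k)))
    (L a n : ℕ) (g : ℕ → ℕ) (hg : ∀ j, j < n → 2 ^ (j + a + L) ≤ g j) :
    ∑ j ∈ range n, ε (g j) ≤ ∑' k, ε (2 ^ (k + L)) := by
  have hnn : ∀ m, 0 ≤ ε m := eps_nonneg hε hsum
  have hsumL : Summable (fun k : ℕ => ε (2 ^ (k + L))) := by
    have := (summable_nat_add_iff (f := fun k : ℕ => ε (2 ^ k)) L).2 hsum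
    simpa using this
  -- termwise bound, then the finite sum over the image {a, …, a+n-1}
  calc ∑ j ∈ range n, ε (g j) ≤ ∑ j ∈ range n, ε (2 ^ ((j + a) + L)) := by
        refine sum_le_sum fun j hj => hε ?_
        have := hg j (mem_range.1 hj)
        simpa [add_assoc] using this
    _ = ∑ k ∈ (range n).image (fun j => j + a), ε (2 ^ (k + L)) := by
        rw [sum_image]
        intro x _ y _ hxy
        simpa using hxy
    _ ≤ ∑' k, ε (2 ^ (k + L)) := by
        exact hsumL.sum_le_tsum _ (fun k _ => hnn _)

/-! ### The glue -/

theorem logScaleRigidity_of_dense (hD : LogTwoLogThreeDense) : LogScaleRigidity := by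
  intro d S C c ε N₀ hc hlow hbdd hslow hε hsum h2 h3
  -- nonnegative Lipschitz constant
  set C' : ℝ := max C 0 with hC'def
  have hC' : 0 ≤ C' := le_max_right _ _
  have hslow' : ∀ N : ℕ, N₀ ≤ N → d N - d (N + 1) ≤ C' / N := fun N hN =>
    (hslow N hN).trans (div_le_div_of_nonneg_right (le_max_left _ _) (Nat.cast_nonneg N))
  have hnn : ∀ m, 0 ≤ ε m := eps_nonneg hε hsum
  -- dyadic tails
  set T : ℕ → ℝ := fun L => ∑' k, ε (2 ^ (k + L)) with hTdef
  have hT0 : Tendsto T atTop (𝓝 0) := by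
    have := tendsto_sum_nat_add (fun k : ℕ => ε (2 ^ k))
    simpa [hTdef] using this
  -- the Cauchy criterion
  have key : ∀ η : ℝ, 0 < η → ∃ K : ℕ, ∃ B : ℝ, ∀ M : ℕ, K ≤ M → B - 5 * η ≤ d M ∧ d M ≤ B := by
    intro η hη
    -- δ with C' δ ≤ η
    set δ : ℝ := η / (C' + 1) with hδdef
    have hδ : 0 < δ := div_pos hη (by linarith)
    have hC'δ : C' * δ ≤ η := by
      rw [hδdef]
      rw [mul_div_assoc']
      rw [div_le_iff₀ (by linarith)]
      nlinarith
    obtain ⟨X₀, hX₀⟩ := hD δ hδ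
    -- L with T L ≤ η
    obtain ⟨L, hL⟩ : ∃ L : ℕ, ∀ L', L ≤ L' → T L' ≤ η := by
      have := (hT0.eventually (ge_mem_nhds hη))
      obtain ⟨L, hL⟩ := eventually_atTop.1 this
      exact ⟨L, hL⟩
    have hTL : T L ≤ η := hL L le_rfl
    -- threshold N₁
    set N₁ : ℕ := max (max N₀ 2) (max (2 ^ L) (⌈1 / δ⌉₊ + 2)) with hN₁def
    have hN₁0 : N₀ ≤ N₁ := (le_max_left _ _).trans (le_max_left _ _)
    have hN₁2 : 2 ≤ N₁ := (le_max_right _ _).trans (le_max_left _ _)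
    have hN₁L : 2 ^ L ≤ N₁ := (le_max_left _ _).trans (le_max_right _ _)
    have hN₁δ : ⌈1 / δ⌉₊ + 2 ≤ N₁ := (le_max_right _ _).trans (le_max_right _ _)
    have hinvδ : ∀ n : ℕ, N₁ ≤ n → 1 / ((n : ℝ) - 1) ≤ δ := by
      intro n hn
      have h1 : (1 / δ : ℝ) ≤ ⌈1 / δ⌉₊ := Nat.le_ceil _
      have h2' : ((⌈1 / δ⌉₊ + 2 : ℕ) : ℝ) ≤ n := by exact_mod_cast hN₁δ.trans hn
      push_cast at h2'
      have hpos : 0 < (n : ℝ) - 1 := by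
        have : (0:ℝ) ≤ ⌈1 / δ⌉₊ := Nat.cast_nonneg _
        linarith
      rw [div_le_iff₀ hpos]
      have : 1 / δ ≤ (n : ℝ) - 1 := by linarith
      calc (1 : ℝ) = (1 / δ) * δ := by field_simp
        _ ≤ ((n : ℝ) - 1) * δ := mul_le_mul_of_nonneg_right this hδ.le
        _ = δ * ((n : ℝ) - 1) := by ring
    -- supremum of the tail beyond N₁
    set s : Set ℝ := Set.range (fun n : ℕ => d (n + N₁)) with hsdef
    have hs_bdd : BddAbove s := ⟨S, by rintro _ ⟨n, rfl⟩; exact hbdd _⟩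
    have hs_ne : s.Nonempty := ⟨d (0 + N₁), ⟨0, rfl⟩⟩
    set B : ℝ := sSup s with hBdef
    have hleB : ∀ M : ℕ, N₁ ≤ M → d M ≤ B := by
      intro M hM
      refine le_csSup hs_bdd ⟨M - N₁, ?_⟩
      simp [Nat.sub_add_cancel hM]
    obtain ⟨_, ⟨nstar, rfl⟩, hnstar⟩ := exists_lt_of_lt_csSup hs_ne (show B - η < B by linarith)
    set Nstar : ℕ := nstar + N₁ with hNstardef
    have hNstar₁ : N₁ ≤ Nstar := Nat.le_add_left _ _
    have hNstar0 : N₀ ≤ Nstar := hN₁0.trans hNstar₁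
    have hNstar2 : (2 : ℝ) ≤ Nstar := by exact_mod_cast hN₁2.trans hNstar₁
    have hNstarpos : (0 : ℝ) < Nstar := by linarith
    have hdNstar : B - η < d Nstar := hnstar
    -- the threshold K
    set X₀' : ℝ := max X₀ 0 with hX₀'def
    set K : ℕ := ⌈(Nstar : ℝ) * Real.exp X₀'⌉₊ + N₁ with hKdef
    refine ⟨K, B, fun M hM => ⟨?_, hleB M ((Nat.le_add_left _ _).trans hM)⟩⟩
    -- M is large: M ≥ Nstar * exp X₀'
    have hMreal : (Nstar : ℝ) * Real.exp X₀' ≤ M := by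
      have h1 : (Nstar : ℝ) * Real.exp X₀' ≤ ⌈(Nstar : ℝ) * Real.exp X₀'⌉₊ := Nat.le_ceil _
      have h2' : ((⌈(Nstar : ℝ) * Real.exp X₀'⌉₊ + N₁ : ℕ) : ℝ) ≤ M := by exact_mod_cast hM
      push_cast at h2'
      have : (0 : ℝ) ≤ N₁ := Nat.cast_nonneg _
      linarith
    have hMpos : (0 : ℝ) < M := lt_of_lt_of_le (by positivity) hMreal
    -- X := log (M / Nstar) ≥ X₀
    set X : ℝ := Real.log ((M : ℝ) / Nstar) with hXdef
    have hX : X₀ ≤ X := by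
      have hx1 : Real.exp X₀' ≤ (M : ℝ) / Nstar := by
        rw [le_div_iff₀ hNstarpos]; linarith
      have : X₀' ≤ X := by
        rw [hXdef, ← Real.log_exp X₀']
        exact Real.log_le_log (Real.exp_pos _) hx1
      exact (le_max_left _ _).trans this
    obtain ⟨a, b, hab1, hab2⟩ := hX₀ X hX
    -- P := 2^a 3^b and its real size
    set P : ℕ := 2 ^ a * 3 ^ b with hPdef
    have hPreal : (P : ℝ) = Real.exp (a * Real.log 2 + b * Real.log 3) := by
      rw [Real.exp_add, Real.exp_nat_mul, Real.exp_nat_mul, Real.exp_log (by norm_num),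
        Real.exp_log (by norm_num)]
      push_cast [hPdef]
      ring
    have hPpos : (0 : ℝ) < P := by rw [hPreal]; exact Real.exp_pos _
    have hexpX : Real.exp X = (M : ℝ) / Nstar := by
      rw [hXdef, Real.exp_log (div_pos hMpos hNstarpos)]
    -- P * Nstar ≤ M
    have hPN_le_M_real : (P : ℝ) * Nstar ≤ M := by
      have : (P : ℝ) ≤ (M : ℝ) / Nstar := by
        rw [hPreal, ← hexpX]; exact Real.exp_le_exp.2 hab2
      rwa [le_div_iff₀ hNstarpos] at this
    have hPN_le_M : P * Nstar ≤ M := by exact_mod_cast hPN_le_M_real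
    -- M ≤ exp δ * P * Nstar
    have hM_le : (M : ℝ) ≤ Real.exp δ * P * Nstar := by
      have : (M : ℝ) / Nstar ≤ Real.exp δ * P := by
        rw [← hexpX, hPreal, ← Real.exp_add]
        exact Real.exp_le_exp.2 (by linarith)
      rw [div_le_iff₀ hNstarpos] at this
      linarith
    -- staircase: d (P * Nstar) ≥ d Nstar - 2 T L
    have hNstarL : 2 ^ L ≤ Nstar := hN₁L.trans hNstar₁
    have hst2 : d Nstar - ∑ i ∈ range a, ε (2 ^ i * Nstar) ≤ d (2 ^ a * Nstar) := stair2 h2 hNstar0 a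
    have hP0 : N₀ ≤ 2 ^ a * Nstar :=
      hNstar0.trans (Nat.le_mul_of_pos_left _ (Nat.pos_of_ne_zero (by positivity)))
    have hst3 : d (2 ^ a * Nstar) - ∑ j ∈ range b, ε (3 ^ j * (2 ^ a * Nstar)) ≤ d (3 ^ b * (2 ^ a * Nstar)) :=
      stair3 h3 hP0 b
    have hsum2 : ∑ i ∈ range a, ε (2 ^ i * Nstar) ≤ T L := by
      refine sum_le_tail hε hsum L 0 a (fun i => 2 ^ i * Nstar) (fun i _ => ?_)
      calc 2 ^ (i + 0 + L) = 2 ^ i * 2 ^ L := by rw [add_zero, pow_add]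
        _ ≤ 2 ^ i * Nstar := Nat.mul_le_mul_left _ hNstarL
    have hsum3 : ∑ j ∈ range b, ε (3 ^ j * (2 ^ a * Nstar)) ≤ T L := by
      refine sum_le_tail hε hsum L a b (fun j => 3 ^ j * (2 ^ a * Nstar)) (fun j _ => ?_)
      calc 2 ^ (j + a + L) = 2 ^ j * (2 ^ a * 2 ^ L) := by rw [pow_add, pow_add, mul_assoc]
        _ ≤ 3 ^ j * (2 ^ a * Nstar) := by
          apply Nat.mul_le_mul (Nat.pow_le_pow_left (by norm_num) j) (Nat.mul_le_mul_left _ hNstarL)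
    have hPN_eq : P * Nstar = 3 ^ b * (2 ^ a * Nstar) := by rw [hPdef]; ring
    have hstair : d Nstar - 2 * T L ≤ d (P * Nstar) := by
      rw [hPN_eq]; linarith
    -- slow decrease from P * Nstar to M
    have hPN₁ : N₁ ≤ P * Nstar := by
      have h1P : 1 ≤ P := Nat.pos_of_ne_zero (by positivity)
      calc N₁ ≤ Nstar := hNstar₁
        _ = 1 * Nstar := (one_mul _).symm
        _ ≤ P * Nstar := Nat.mul_le_mul_right _ h1P
    have hPN0 : N₀ ≤ P * Nstar := hN₁0.trans hPN₁
    have hPN2 : 2 ≤ P * Nstar := hN₁2.trans hPN₁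
    have hslowsum := slow_sum hC' hslow' hPN0 hPN2 M hPN_le_M
    -- bound the log difference by δ + 1/(P Nstar - 1) ≤ 2δ
    have hPNreal2 : (2 : ℝ) ≤ (P * Nstar : ℕ) := by exact_mod_cast hPN2
    have hPNpos : (0 : ℝ) < (P * Nstar : ℕ) := by linarith
    have hPN1pos : (0 : ℝ) < ((P * Nstar : ℕ) : ℝ) - 1 := by linarith
    have hMreal2 : (2 : ℝ) ≤ M := hPNreal2.trans (by exact_mod_cast hPN_le_M)
    have hM1pos : (0 : ℝ) < (M : ℝ) - 1 := by linarith
    have hlog1 : Real.log ((M : ℝ) - 1) ≤ Real.log M := Real.log_le_log hM1pos (by linarith)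
    have hlog2 : Real.log (M : ℝ) - Real.log ((P * Nstar : ℕ) : ℝ) ≤ δ := by
      have hq : (M : ℝ) / ((P * Nstar : ℕ) : ℝ) ≤ Real.exp δ := by
        rw [div_le_iff₀ hPNpos]; push_cast; linarith
      have := Real.log_le_log (div_pos hMpos hPNpos) hq
      rwa [Real.log_exp, Real.log_div hMpos.ne' hPNpos.ne'] at this
    have hlog3 : Real.log ((P * Nstar : ℕ) : ℝ) - Real.log (((P * Nstar : ℕ) : ℝ) - 1) ≤ δ := by
      -- log(x/(x-1)) = -log((x-1)/x) ≤ -(1 - x/(x-1)) = 1/(x-1)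
      have hx := Real.one_sub_inv_le_log_of_pos (div_pos hPN1pos hPNpos)
      rw [Real.log_div hPN1pos.ne' hPNpos.ne'] at hx
      have hinv : 1 - ((((P * Nstar : ℕ) : ℝ) - 1) / ((P * Nstar : ℕ) : ℝ))⁻¹
          = -(1 / ((((P * Nstar : ℕ) : ℝ) - 1))) := by
        field_simp
        ring
      rw [hinv] at hx
      have := hinvδ (P * Nstar) hPN₁
      linarith
    have hslow_final : d (P * Nstar) - d M ≤ 2 * η := by
      have : Real.log ((M : ℝ) - 1) - Real.log (((P * Nstar : ℕ) : ℝ) - 1) ≤ 2 * δ := by linarith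
      calc d (P * Nstar) - d M ≤ C' * (Real.log ((M : ℝ) - 1) - Real.log (((P * Nstar : ℕ) : ℝ) - 1)) :=
            hslowsum
        _ ≤ C' * (2 * δ) := mul_le_mul_of_nonneg_left this hC'
        _ = 2 * (C' * δ) := by ring
        _ ≤ 2 * η := by linarith
    -- assemble
    linarith
  -- Cauchy ⇒ convergent
  have hcauchy : CauchySeq d := by
    refine Metric.cauchySeq_iff.2 fun e he => ?_
    obtain ⟨K, B, hK⟩ := key (e / 6) (by positivity)
    refine ⟨K, fun m hm n hn => ?_⟩
    obtain ⟨hm1, hm2⟩ := hK m hm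
    obtain ⟨hn1, hn2⟩ := hK n hn
    rw [Real.dist_eq, abs_sub_lt_iff]
    constructor <;> linarith
  obtain ⟨k, hk⟩ := cauchySeq_tendsto_of_complete hcauchy
  refine ⟨k, lt_of_lt_of_le hc ?_, hk⟩
  exact ge_of_tendsto hk (eventually_atTop.2 ⟨N₀, fun N hN => hlow N hN⟩)


/-! ### The Kronecker-density input, proved (so the glue is unconditional) -/

/-- Generic staircase covering: with a step `θ ∈ (0, δ]` and a coarse grid of mesh `α > 0`, every large `X`
is approximated from below within `δ` by `K α + m θ` with the side budget `p * m ≤ K`. -/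
theorem staircase (α θ δ : ℝ) (p : ℕ) (hα : 0 < α) (hθ : 0 < θ) (hθδ : θ ≤ δ) :
    ∃ X₀ : ℝ, ∀ X : ℝ, X₀ ≤ X → ∃ K m : ℕ, p * m ≤ K ∧ X - δ ≤ K * α + m * θ ∧ K * α + m * θ ≤ X := by
  refine ⟨(p * (α / θ + 1) + 1) * α, fun X hX => ?_⟩
  have hpos0 : 0 ≤ (p : ℝ) * (α / θ + 1) := by positivity
  have hX0 : 0 ≤ X := le_trans (by positivity) hX
  set K : ℕ := ⌊X / α⌋₊ with hKdef
  have hK1 : (K : ℝ) ≤ X / α := Nat.floor_le (div_nonneg hX0 hα.le)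
  have hK2 : X / α < K + 1 := Nat.lt_floor_add_one _
  set r : ℝ := X - K * α with hrdef
  have hr0 : 0 ≤ r := by
    have : (K : ℝ) * α ≤ X := by rwa [le_div_iff₀ hα] at hK1
    linarith
  have hrα : r < α := by
    have : X < (K + 1) * α := by rwa [div_lt_iff₀ hα] at hK2
    rw [hrdef]; linarith
  set m : ℕ := ⌊r / θ⌋₊ with hmdef
  have hm1 : (m : ℝ) ≤ r / θ := Nat.floor_le (div_nonneg hr0 hθ.le)
  have hm2 : r / θ < m + 1 := Nat.lt_floor_add_one _
  have hmθ : (m : ℝ) * θ ≤ r := by rwa [le_div_iff₀ hθ] at hm1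
  have hmθ2 : r < (m + 1) * θ := by rwa [div_lt_iff₀ hθ] at hm2
  refine ⟨K, m, ?_, ?_, ?_⟩
  · -- p m ≤ K, via reals
    have hmlt : (m : ℝ) < α / θ + 1 := by
      have : r / θ < α / θ := div_lt_div_of_pos_right hrα hθ
      linarith
    have hKge : (p : ℝ) * (α / θ + 1) ≤ K := by
      have h1 : (p * (α / θ + 1) + 1) * α ≤ X := hX
      have h2 : (p : ℝ) * (α / θ + 1) + 1 ≤ X / α := by rwa [le_div_iff₀ hα]
      linarith
    have : (p : ℝ) * m ≤ K := by
      calc (p : ℝ) * m ≤ p * (α / θ + 1) := mul_le_mul_of_nonneg_left hmlt.le (Nat.cast_nonneg p)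
        _ ≤ K := hKge
    exact_mod_cast this
  · rw [hrdef] at hmθ2; nlinarith
  · rw [hrdef] at hmθ; linarith

/-- `2^u ≠ 3^v` for `u, v ≥ 1` (parity), in the logarithmic form used below. -/
theorem log_two_three_independent {u v : ℕ} (hu : 1 ≤ u) (_hv : 1 ≤ v) :
    (v : ℝ) * Real.log 3 - u * Real.log 2 ≠ 0 := by
  intro h
  have h1 : (v : ℝ) * Real.log 3 = u * Real.log 2 := by linarith
  have h2 : Real.exp ((v : ℝ) * Real.log 3) = Real.exp (u * Real.log 2) := by rw [h1]
  rw [Real.exp_nat_mul, Real.exp_nat_mul, Real.exp_log (by norm_num), Real.exp_log (by norm_num)] at h2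
  have h3 : (3 : ℕ) ^ v = 2 ^ u := by exact_mod_cast h2
  have hodd : Odd ((3 : ℕ) ^ v) := Odd.pow (by decide)
  have heven : Even ((2 : ℕ) ^ u) := (Nat.even_pow' (by omega)).2 (by decide)
  rw [h3] at hodd
  exact (Nat.not_even_iff_odd.2 hodd) heven

theorem logTwoLogThreeDense : LogTwoLogThreeDense := by
  intro δ hδ
  have hl2 : 0 < Real.log 2 := Real.log_pos (by norm_num)
  have hl3 : Real.log 2 < Real.log 3 := Real.log_lt_log (by norm_num) (by norm_num)
  set ξ : ℝ := Real.log 3 / Real.log 2 with hξdef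
  have hξ1 : 1 < ξ := by rw [hξdef, one_lt_div hl2]; exact hl3
  -- Dirichlet: |k ξ - j| ≤ 1/(n+1) with log 2 / (n+1) < δ
  set n : ℕ := ⌈Real.log 2 / δ⌉₊ + 1 with hndef
  have hnpos : 0 < n := Nat.succ_pos _
  have hnδ : Real.log 2 / ((n : ℝ) + 1) < δ := by
    have h1 : Real.log 2 / δ ≤ ⌈Real.log 2 / δ⌉₊ := Nat.le_ceil _
    have h2' : (n : ℝ) = ⌈Real.log 2 / δ⌉₊ + 1 := by rw [hndef]; push_cast; ring
    rw [div_lt_iff₀ (by positivity)]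
    have : Real.log 2 / δ < (n : ℝ) + 1 := by rw [h2']; linarith
    rw [div_lt_iff₀ hδ] at this
    linarith
  obtain ⟨j, k, hk0, _hkn, habs⟩ := Real.exists_int_int_abs_mul_sub_le ξ hnpos
  -- j ≥ 1
  have hn1 : (1 : ℝ) ≤ n := by exact_mod_cast hnpos
  have habs' : |(k : ℝ) * ξ - j| ≤ 1 / 2 := by
    refine habs.trans ?_
    rw [div_le_div_iff₀ (by positivity) (by norm_num)]
    linarith
  have hkξ : ξ ≤ (k : ℝ) * ξ := by
    have : (1 : ℝ) ≤ k := by exact_mod_cast hk0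
    nlinarith
  have hj0 : (0 : ℤ) < j := by
    have : (1 / 2 : ℝ) < j := by
      have := (abs_sub_le_iff.1 habs').1
      linarith
    exact_mod_cast (show (0 : ℝ) < j by linarith)
  obtain ⟨k', hk'⟩ := Int.eq_ofNat_of_zero_le hk0.le
  obtain ⟨j', hj'⟩ := Int.eq_ofNat_of_zero_le hj0.le
  have hk'1 : 1 ≤ k' := by omega
  have hj'1 : 1 ≤ j' := by omega
  -- θ₀ := k log 3 - j log 2 = log 2 · (k ξ - j)
  set θ₀ : ℝ := (k' : ℝ) * Real.log 3 - j' * Real.log 2 with hθ₀def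
  have hθ₀eq : θ₀ = Real.log 2 * ((k : ℝ) * ξ - j) := by
    rw [hθ₀def, hk', hj', hξdef]; push_cast
    field_simp
  have hθ₀abs : |θ₀| < δ := by
    rw [hθ₀eq, abs_mul, abs_of_pos hl2]
    calc Real.log 2 * |(k : ℝ) * ξ - j| ≤ Real.log 2 * (1 / ((n : ℝ) + 1)) :=
          mul_le_mul_of_nonneg_left habs hl2.le
      _ = Real.log 2 / ((n : ℝ) + 1) := by ring
      _ < δ := hnδ
  have hθ₀ne : θ₀ ≠ 0 := log_two_three_independent hj'1 hk'1
  rcases lt_or_gt_of_ne hθ₀ne with hneg | hpos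
  · -- θ := -θ₀ = j' log 2 - k' log 3 > 0; grid α = log 3, budget p = k'
    have hθ : 0 < -θ₀ := by linarith
    have hθδ : -θ₀ ≤ δ := by have := (abs_lt.1 hθ₀abs).1; linarith
    obtain ⟨X₀, hX₀⟩ := staircase (Real.log 3) (-θ₀) δ k' (by linarith) hθ hθδ
    refine ⟨X₀, fun X hX => ?_⟩
    obtain ⟨K, m, hpm, h1, h2⟩ := hX₀ X hX
    refine ⟨m * j', K - k' * m, ?_, ?_⟩ <;>
    · have hcast : ((K - k' * m : ℕ) : ℝ) = K - k' * m := by push_cast [Nat.cast_sub hpm]; ring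
      have hid : ((m * j' : ℕ) : ℝ) * Real.log 2 + ((K - k' * m : ℕ) : ℝ) * Real.log 3
          = K * Real.log 3 + m * (-θ₀) := by
        rw [hcast, hθ₀def]; push_cast; ring
      rw [hid]; assumption
  · -- θ := θ₀ > 0; grid α = log 2, budget p = j'
    have hθδ : θ₀ ≤ δ := (abs_lt.1 hθ₀abs).2.le
    obtain ⟨X₀, hX₀⟩ := staircase (Real.log 2) θ₀ δ j' hl2 hpos hθδ
    refine ⟨X₀, fun X hX => ?_⟩
    obtain ⟨K, m, hpm, h1, h2⟩ := hX₀ X hX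
    refine ⟨K - j' * m, m * k', ?_, ?_⟩ <;>
    · have hcast : ((K - j' * m : ℕ) : ℝ) = K - j' * m := by push_cast [Nat.cast_sub hpm]; ring
      have hid : ((K - j' * m : ℕ) : ℝ) * Real.log 2 + ((m * k' : ℕ) : ℝ) * Real.log 3
          = K * Real.log 2 + m * θ₀ := by
        rw [hcast, hθ₀def]; push_cast; ring
      rw [hid]; assumption

/-- **The glue of the card, unconditionally.** -/
theorem logScaleRigidity : LogScaleRigidity :=
  logScaleRigidity_of_dense logTwoLogThreeDense


end Glue

/-! ## Part II — registered stubs (the lemmas of the line; `sorry` only here)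

Shape (D-0027 §3.3, device of `Lines/balanced-split-concavity-transfer.lean`): each stub is a sorried theorem
`Holds.stub_<name> : <full statement> := by sorry` — `ledger skeleton check` registers it under the short name
`stub_<name>` with THAT statement text as its signature (self-contained over tree declarations: the crux's
quantifier prefix verbatim, resistances written out as `((N:ℝ) − 1)/D N`) — plus the by-name handle
`def stub_<name> : Prop := type_of% Holds.stub_<name>` which the layer-invariant audit (`#h21_check_skeleton`)
requires of the hypotheses of `BoundedResponseConverges_of`. -/

/-- **Stub 1 — PositiveConductance (P): `D_N > 0` at every finite length `N ≥ 2` (fixed-`N` analysis; size M).**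
Under the crux's prefix (parameters `> 0`, weak-NESS uniqueness, a steady family, `T > 0`, response coefficients
`D` of clause (ii)): `∀ N ≥ 2, 0 < D N`. VERBATIM the route item `FeketeSeriesLaw.PositiveConductance`
(stmt-AtomisticToContinuum-11750, support, M; `positiveConductance_iff` below is `Iff.rfl`), so one proof closes both.
Content: the finite-volume Kubo formula `(N−1)T²D_N = ∫₀^∞⟨J, P_tJ⟩_Gibbs dt = ⟨u, (−L)u⟩ = γT Σ_{b∈{0,N−1}}‖∂_{p_b}u‖²`
(`u` the Kubo corrector, `L u = −J`; ReyBellet2003 Rem. 4.4, KunduDharNarayan2009 (reln2)–(reln3); in tree the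
identity is `OddSectorIrreversibility.CorrectorTheory` (6)) is NON-DEGENERATE: `∂_{p_0}u ≡ ∂_{p_{N−1}}u ≡ 0` would
make `J = −A u` a coboundary of the CLOSED flow with `u` independent of the contact momenta, and commuting `∂_{p_0}`
through `A` forces `∂_{q_0}u = ½V′(q_1 − q_0)`, … — a finite Hörmander-type bracket recursion excludes it for the
quartic chain. Why it might fail: strict positivity of the LINEAR coefficient is not in print for Langevin baths
(EckmannPilletReyBellet1999b give positivity of entropy production at `T_L ≠ T_R`, which still allows `J = O(δ³)`).
Harmonic corner: true (`D_{M+1} = M·fluxCoeff > 0`). Role here: makes `R_N = (N−1)/D_N` a resistance in (U),(S23)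
and, with (U), PRODUCES the floor `liminf D_N ≥ 1/C` (= `JunctionLocality.ConductanceLowerBound`, see
`conductanceLowerBound_of_stubs`). Disproof: answers `not_convergesAlong_gibbsFamily` /
`boundedResponseConverges_false_without_unique_gamma_zero` (`D ≡ 0` violates (P)). -/
theorem Holds.stub_positiveConductance :
    ∀ ω₂ lam β γ : ℝ, 0 < ω₂ → 0 < lam → 0 < β → 0 < γ →
    (∀ (N : ℕ) (T_L T_R : ℝ), 0 < T_L → 0 < T_R →
      ∀ μ ν : MeasureTheory.Measure (Literature.MathematicalPhysics.KineticTheory.HeatConduction.PhaseSpace N),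
        (Literature.MathematicalPhysics.KineticTheory.HeatConduction.pinnedChain ω₂ lam β γ).IsSteadyState N T_L T_R μ →
        (Literature.MathematicalPhysics.KineticTheory.HeatConduction.pinnedChain ω₂ lam β γ).IsSteadyState N T_L T_R ν →
        μ = ν) →
    ∀ μ : (N : ℕ) → ℝ → ℝ →
        MeasureTheory.Measure (Literature.MathematicalPhysics.KineticTheory.HeatConduction.PhaseSpace N),
    (∀ (N : ℕ) (T_L T_R : ℝ), 0 < T_L → 0 < T_R →
      (Literature.MathematicalPhysics.KineticTheory.HeatConduction.pinnedChain ω₂ lam β γ).IsSteadyState N T_L T_R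
        (μ N T_L T_R)) →
    ∀ T : ℝ, 0 < T → ∀ D : ℕ → ℝ,
    (∀ N : ℕ, Filter.Tendsto (fun δ : ℝ =>
        (Literature.MathematicalPhysics.KineticTheory.HeatConduction.pinnedChain ω₂ lam β γ).totalCurrent
          (μ N (T + δ / 2) (T - δ / 2)) / δ) (nhdsWithin 0 {(0 : ℝ)}ᶜ) (nhds (D N))) →
    ∀ N : ℕ, 2 ≤ N → 0 < D N := by
  sorry

/-- **Stub 2 — UpperIncrement (U): one more bead costs at most `C` resistance (local, one-sided; size XL).**
Under the crux's prefix and `D_N > 0` for `N ≥ 2` (= stub 1): `∃ C N₀ ∀ N ≥ N₀, R_{N+1} ≤ R_N + C`, i.e.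
`N/D_{N+1} ≤ (N−1)/D_N + C`. Adding one bead between the last bead and its bath (the new bead inherits the Langevin
contact, the old contact bead becomes interior) raises the end-to-end resistance by at most a `T`-dependent constant:
the UPPER half of a Kapitza/one-site insertion lemma read on the actual length orbit (ParabolicBathMap's two-sided
`JunctionLocality` stmt-11920 asks `|1/g′ − 1/g − r| ≤ ε`; MatthiessenLadder's `PrefixIncrementLimit` asks
`r_N → r*`; here ONLY `r_N ≤ C`, oscillating increments allowed). Phenomenology: affine law `R_N ≈ (N + 2ℓ_c)/κ`
for pinned chains (AokiKusnezov2001; LepriLiviPoliti2003 §3.4) gives `r_N → 1/κ`; quasi-ballistic regime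
`N ≪ ℓ_mfp(T)`: `R_N ≈ const`, `r_N ≈ 0` — friendly. Harmonic corner: true (`R_N = 1/fluxCoeff_N → 1/fluxLimit`,
`r_N → 0`; `tendsto_fluxCoeff`, `fluxLimit_pos`). NOT implied by the crux (`D_N = κ + (−1)^N/√N` converges but
`r_N ≈ 1/κ + 2(−1)^N√N/κ²`, triage r1-1/2) and does not imply it (`R_N = N(1 + ½ sin(log log N))`: increments
bounded, `D_N` bounded in `[2/3, 2]` without a limit — there (S23) fails, `ε(N) ≍ 1/log N`; it is (S23) that
decides). What it buys in the composition: with `S = sup D` the Tauberian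
modulus `D_N − D_{N+1} = [(N−1)r_N − R_N]/(R_N R_{N+1}) ≤ C S²/(N−1)` (kills the oscillating skeleton mode
`2 + (−1)^N`) and, telescoped, `R_N ≤ R_{N₀} + C(N − N₀)`, i.e. the floor `liminf D_N ≥ 1/C`
(= `ConductanceLowerBound`, stmt-11749 — the honest price: positivity is RELOCATED here, triage r1-2).
Why it might fail: an `N`-uniform bound on ANY length increment of the NESS resistance of a deterministic
anharmonic chain is open (BonettoLebowitzReyBellet2000 §6.3: "nothing is known about the dependence of D on L");
a diverging one-site parity effect (`r_N ≍ ±N^a`) would break it with Fourier intact — printed only for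
integrable/harmonic junctions, where the crux is vacuous. Candidate engines: a one-site insertion comparison of the
two NESS via the fixed-`N` corrector calculus (`OddSectorIrreversibility.CorrectorTheory`) with a relative-entropy /
Girsanov control of moving the Langevin contact by one site; or monotonicity `D_N ≤ D_{N+1}` eventually (ladder lever,
`increment_of_monotone` below). -/
theorem Holds.stub_upperIncrement :
    ∀ ω₂ lam β γ : ℝ, 0 < ω₂ → 0 < lam → 0 < β → 0 < γ →
    (∀ (N : ℕ) (T_L T_R : ℝ), 0 < T_L → 0 < T_R →
      ∀ μ ν : MeasureTheory.Measure (Literature.MathematicalPhysics.KineticTheory.HeatConduction.PhaseSpace N),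
        (Literature.MathematicalPhysics.KineticTheory.HeatConduction.pinnedChain ω₂ lam β γ).IsSteadyState N T_L T_R μ →
        (Literature.MathematicalPhysics.KineticTheory.HeatConduction.pinnedChain ω₂ lam β γ).IsSteadyState N T_L T_R ν →
        μ = ν) →
    ∀ μ : (N : ℕ) → ℝ → ℝ →
        MeasureTheory.Measure (Literature.MathematicalPhysics.KineticTheory.HeatConduction.PhaseSpace N),
    (∀ (N : ℕ) (T_L T_R : ℝ), 0 < T_L → 0 < T_R →
      (Literature.MathematicalPhysics.KineticTheory.HeatConduction.pinnedChain ω₂ lam β γ).IsSteadyState N T_L T_R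
        (μ N T_L T_R)) →
    ∀ T : ℝ, 0 < T → ∀ D : ℕ → ℝ,
    (∀ N : ℕ, Filter.Tendsto (fun δ : ℝ =>
        (Literature.MathematicalPhysics.KineticTheory.HeatConduction.pinnedChain ω₂ lam β γ).totalCurrent
          (μ N (T + δ / 2) (T - δ / 2)) / δ) (nhdsWithin 0 {(0 : ℝ)}ᶜ) (nhds (D N))) →
    (∀ N : ℕ, 2 ≤ N → 0 < D N) →
    ∃ C : ℝ, ∃ N₀ : ℕ, ∀ N : ℕ, N₀ ≤ N →
      (((N + 1 : ℕ) : ℝ) - 1) / D (N + 1) ≤ ((N : ℝ) - 1) / D N + C := by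
  sorry

/-- **Stub 3 — SelfSimilarGluing (S23): one-sided, sub-extensive subadditivity at the two self-similar junctions
only (global, one-sided; size XL; HARDEST — the line's convergence mechanism).** Under the crux's prefix and
`D_N > 0` for `N ≥ 2`: `∃ ε : ℕ → ℝ` ANTITONE with `Σ_k ε(2^k) < ∞` (a Dini condition in `log N`; `ε(N) = (log N)^{−1−α}`
or `N^{−η}` qualify) and `∃ N₀ ∀ N ≥ N₀`: `R_{2N} ≤ 2R_N + N ε(N)` and `R_{3N} ≤ 3R_N + N ε(N)`. Gluing `k = 2, 3`
copies of the `N`-chain end to end (a trial state is literally `k` copies of the `N`-NESS plus `k − 1` identical local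
repairs of the removed contact pairs, healed over a mesoscopic window `w_N = N^θ`: loss `O(w_N) + N·(contact-layer
tail beyond w_N)`) costs at most a sub-extensive amount of resistance. The ONLY junctions are self-similar: the
`2N`-chain `N ⊕ N` is mapped to itself by `i ↦ 2N−1−i, δ ↦ −δ`, so under uniqueness its first-order response density
is reflection-odd, the junction pair sits at first-order temperature exactly `T` and every reflection-even junction
observable is silent at first order (the configuration the SuperadditiveResistance panel singled out as the clean
one); `N ⊕ N ⊕ N` is mapped to itself by `i ↦ 3N−1−i` (swaps the two junctions, each joining IDENTICAL blocks).
Never cuts a chain (no Thomson/restriction side), never compares chains of different lengths, no junction constant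
of either sign. Phenomenology: affine law ⇒ `R_{2N} − 2R_N = −2ℓ_c/κ < 0` (ε ≡ 0); kinetic parallel-channel
(Knudsen) laws, incl. fat mfp tails where `SuperadditiveResistance` dies: ε ≡ 0; overshoot worlds `D_N ↓ κ` need
`ε > 0`: `κ(1 + cN^{−a})` ⇒ `ε ≍ N^{−a}` ✓, `κ(1 + c/log N)` ⇒ `R_{2N} − 2R_N ≈ 1/κ + 2c log2·N/(κ log²N)`,
`ε(2^k) ≍ 1/k²` ✓ (corrects triage r1-3), likewise `κ(1 + c/(log log N)^a)` and every monotone relaxation with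
regularly varying correction (the dyadic decrements `D_N − D_{2N}` telescope). Its real enemy: a log-scale
OSCILLATION of `D_N` with infinite variation along the dyadic orbit
(`D_N = 2 + sin(log log N)`: slack `≍ 1/log N`, `Σ_k 1/k = ∞`) — an RG limit cycle in the length, which nobody
expects for a homogeneous chain at fixed `T` but nothing in print excludes. Harmonic corner: true with ε ≡ 0
(`R_{2N} − 2R_N → −1/fluxLimit < 0`). NOT implied by the crux (needs Dini-summable slack) and does not imply it
without `BddAbove` (`Negative/LoadBearing`: `_false_without_bddAbove_harmonic`). Why it might fail: no variational
(Dirichlet/Thomson) characterisation of `R_N` is known for the boundary-noise hypoelliptic chain (LandimMarianiSeo2018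
is for non-degenerate diffusions; triage r1-1), so "trial state ⇒ one-sided bound" is itself to be built — e.g. from
the open-chain Kubo formula `(N−1)T²D_N = ⟨J_N, (−L_N)⁻¹J_N⟩` (KunduDharNarayan2009) and the relative entropy of the
glued product NESS w.r.t. the `kN`-NESS (cutoff gluing loses boundary layers, `o(volume)`: ArmstrongKuusiMourrat2019
Ch. 1–2). What it buys: with `S = sup D`, `D_{kN} − D_N ≥ −S²ε(N)` (`k = 2, 3`), the two "almost nondecreasing under
×2, ×3" inputs of `Glue.logScaleRigidity`. -/
theorem Holds.stub_selfSimilarGluing :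
    ∀ ω₂ lam β γ : ℝ, 0 < ω₂ → 0 < lam → 0 < β → 0 < γ →
    (∀ (N : ℕ) (T_L T_R : ℝ), 0 < T_L → 0 < T_R →
      ∀ μ ν : MeasureTheory.Measure (Literature.MathematicalPhysics.KineticTheory.HeatConduction.PhaseSpace N),
        (Literature.MathematicalPhysics.KineticTheory.HeatConduction.pinnedChain ω₂ lam β γ).IsSteadyState N T_L T_R μ →
        (Literature.MathematicalPhysics.KineticTheory.HeatConduction.pinnedChain ω₂ lam β γ).IsSteadyState N T_L T_R ν →
        μ = ν) →
    ∀ μ : (N : ℕ) → ℝ → ℝ →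
        MeasureTheory.Measure (Literature.MathematicalPhysics.KineticTheory.HeatConduction.PhaseSpace N),
    (∀ (N : ℕ) (T_L T_R : ℝ), 0 < T_L → 0 < T_R →
      (Literature.MathematicalPhysics.KineticTheory.HeatConduction.pinnedChain ω₂ lam β γ).IsSteadyState N T_L T_R
        (μ N T_L T_R)) →
    ∀ T : ℝ, 0 < T → ∀ D : ℕ → ℝ,
    (∀ N : ℕ, Filter.Tendsto (fun δ : ℝ =>
        (Literature.MathematicalPhysics.KineticTheory.HeatConduction.pinnedChain ω₂ lam β γ).totalCurrent
          (μ N (T + δ / 2) (T - δ / 2)) / δ) (nhdsWithin 0 {(0 : ℝ)}ᶜ) (nhds (D N))) →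
    (∀ N : ℕ, 2 ≤ N → 0 < D N) →
    ∃ ε : ℕ → ℝ, Antitone ε ∧ Summable (fun k : ℕ => ε (2 ^ k)) ∧
      ∃ N₀ : ℕ, ∀ N : ℕ, N₀ ≤ N →
        (((2 * N : ℕ) : ℝ) - 1) / D (2 * N) ≤ 2 * (((N : ℝ) - 1) / D N) + (N : ℝ) * ε N ∧
        (((3 * N : ℕ) : ℝ) - 1) / D (3 * N) ≤ 3 * (((N : ℝ) - 1) / D N) + (N : ℝ) * ε N := by
  sorry

/-! ### By-name handles of the three statements (no second copy of the text) -/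

/-- Statement of registered stub 1 (`Holds.stub_positiveConductance`), by name. -/
def stub_positiveConductance : Prop := type_of% Holds.stub_positiveConductance

/-- Statement of registered stub 2 (`Holds.stub_upperIncrement`), by name. -/
def stub_upperIncrement : Prop := type_of% Holds.stub_upperIncrement

/-- Statement of registered stub 3 (`Holds.stub_selfSimilarGluing`), by name. -/
def stub_selfSimilarGluing : Prop := type_of% Holds.stub_selfSimilarGluing

/-- Stub 1 IS the route item `FeketeSeriesLaw.PositiveConductance` (stmt-AtomisticToContinuum-11750), definitionally:
a proof of either closes the other. [folklore] -/
theorem positiveConductance_iff :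
    stub_positiveConductance ↔ Summit.AtomisticToContinuum.FouriersLaw.Theses.FeketeSeriesLaw.PositiveConductance :=
  Iff.rfl

/-! ## Part III — the composition at sequence level (sorry-free inequality bookkeeping) -/

/-- The bath-to-bath linear-response RESISTANCE read off a response sequence: `R_N = (N−1)/D_N` (junk where
`D_N = 0`; used only under `0 < D_N`). Local shorthand for the proofs; the stubs spell it out. -/
def resistance (D : ℕ → ℝ) (N : ℕ) : ℝ := ((N : ℝ) - 1) / D N

/-- **Sequence-level composition.** A real sequence `D` bounded above by `S`, positive from `N = 2` on, whose
resistances `R_N = (N−1)/D_N` have increments `≤ C'` from `N₁` on and satisfy the self-similar gluing bounds with an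
antitone, dyadically summable slack from `N₂` on, converges to a positive limit. Proof: floor `1/(2·max(C'⁺, R_{N₀}))`,
modulus `D_N − D_{N+1} ≤ 2C'⁺S²/N`, conversions `D_{kN} ≥ D_N − S²ε(N)` (`k = 2, 3`), then `Glue.logScaleRigidity`.
[folklore] -/
theorem tendsto_of_increment_of_gluing {D : ℕ → ℝ} {S C' : ℝ} {ε : ℕ → ℝ} {N₁ N₂ : ℕ}
    (hDS : ∀ N, D N ≤ S) (hpos2 : ∀ N : ℕ, 2 ≤ N → 0 < D N)
    (hU' : ∀ N : ℕ, N₁ ≤ N → (((N + 1 : ℕ) : ℝ) - 1) / D (N + 1) ≤ ((N : ℝ) - 1) / D N + C')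
    (hεa : Antitone ε) (hεs : Summable (fun k : ℕ => ε (2 ^ k)))
    (hS' : ∀ N : ℕ, N₂ ≤ N →
      (((2 * N : ℕ) : ℝ) - 1) / D (2 * N) ≤ 2 * (((N : ℝ) - 1) / D N) + (N : ℝ) * ε N ∧
      (((3 * N : ℕ) : ℝ) - 1) / D (3 * N) ≤ 3 * (((N : ℝ) - 1) / D N) + (N : ℝ) * ε N) :
    ∃ k : ℝ, 0 < k ∧ Tendsto D atTop (𝓝 k) := by
  -- resistance handles (definitional)
  have hUr : ∀ N, N₁ ≤ N → resistance D (N + 1) ≤ resistance D N + C' := fun N hN => hU' N hN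
  have hSr : ∀ N, N₂ ≤ N → resistance D (2 * N) ≤ 2 * resistance D N + N * ε N ∧
      resistance D (3 * N) ≤ 3 * resistance D N + N * ε N := fun N hN => hS' N hN
  have hεnn : ∀ n, 0 ≤ ε n := Glue.eps_nonneg hεa hεs
  -- thresholds
  set N₀ : ℕ := max (max N₁ N₂) 2 with hN₀def
  have hN₀1 : N₁ ≤ N₀ := (le_max_left _ _).trans (le_max_left _ _)
  have hN₀2 : N₂ ≤ N₀ := (le_max_right _ _).trans (le_max_left _ _)
  have hN₀two : 2 ≤ N₀ := le_max_right _ _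
  have hpos : ∀ N, N₀ ≤ N → 0 < D N := fun N hN => hpos2 N (hN₀two.trans hN)
  have hSpos : 0 < S := (hpos N₀ le_rfl).trans_le (hDS N₀)
  -- resistance bookkeeping
  have hRdef : ∀ N, resistance D N = ((N : ℝ) - 1) / D N := fun _ => rfl
  have hN1pos : ∀ N, N₀ ≤ N → (0 : ℝ) < (N : ℝ) - 1 := by
    intro N hN
    have : (2 : ℝ) ≤ N := by exact_mod_cast hN₀two.trans hN
    linarith
  have hRpos : ∀ N, N₀ ≤ N → 0 < resistance D N := fun N hN =>
    div_pos (hN1pos N hN) (hpos N hN)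
  have hRlow : ∀ N, N₀ ≤ N → ((N : ℝ) - 1) / S ≤ resistance D N := fun N hN =>
    div_le_div_of_nonneg_left (hN1pos N hN).le (hpos N hN) (hDS N)
  have hDeq : ∀ N, N₀ ≤ N → D N = ((N : ℝ) - 1) / resistance D N := by
    intro N hN
    have h1 := (hN1pos N hN).ne'
    have h2 := (hpos N hN).ne'
    rw [hRdef]
    field_simp
  have hinvR : ∀ N, N₀ ≤ N → 1 / resistance D N ≤ S / ((N : ℝ) - 1) := by
    intro N hN
    have h := hRlow N hN
    rw [div_le_div_iff₀ (hRpos N hN) (hN1pos N hN), one_mul]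
    rw [div_le_iff₀ hSpos] at h
    linarith
  -- (1) linear upper bound on the resistance and the floor
  set Cp : ℝ := max C' 0 with hCpdef
  have hCp : 0 ≤ Cp := le_max_right _ _
  have hstep : ∀ N, N₀ ≤ N → resistance D (N + 1) ≤ resistance D N + Cp := fun N hN =>
    (hUr N (hN₀1.trans hN)).trans (by simp [hCpdef])
  have hRup : ∀ N, N₀ ≤ N → resistance D N ≤ resistance D N₀ + Cp * ((N : ℝ) - N₀) := by
    refine Nat.le_induction ?_ ?_
    · simp
    · intro N hN ih
      calc resistance D (N + 1) ≤ resistance D N + Cp := hstep N hN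
        _ ≤ resistance D N₀ + Cp * ((N : ℝ) - N₀) + Cp := by linarith
        _ = resistance D N₀ + Cp * (((N + 1 : ℕ) : ℝ) - N₀) := by push_cast; ring
  set Cq : ℝ := max Cp (resistance D N₀) with hCqdef
  have hCqpos : 0 < Cq := (hRpos N₀ le_rfl).trans_le (le_max_right _ _)
  have hRlin : ∀ N, N₀ ≤ N → resistance D N ≤ Cq * N := by
    intro N hN
    have h1 : resistance D N₀ ≤ Cq := le_max_right _ _
    have h2 : Cp ≤ Cq := le_max_left _ _
    have hNN : ((N₀ : ℕ) : ℝ) ≤ N := by exact_mod_cast hN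
    have hN₀one : (1 : ℝ) ≤ N₀ := by exact_mod_cast (le_trans (by norm_num) hN₀two)
    have hsub : (0 : ℝ) ≤ (N : ℝ) - N₀ := by linarith
    calc resistance D N ≤ resistance D N₀ + Cp * ((N : ℝ) - N₀) := hRup N hN
      _ ≤ Cq + Cq * ((N : ℝ) - N₀) := add_le_add h1 (mul_le_mul_of_nonneg_right h2 hsub)
      _ = Cq * (1 + ((N : ℝ) - N₀)) := by ring
      _ ≤ Cq * N := mul_le_mul_of_nonneg_left (by linarith) hCqpos.le
  have hfloor : ∀ N, N₀ ≤ N → 1 / (2 * Cq) ≤ D N := by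
    intro N hN
    have hNr : (2 : ℝ) ≤ N := by exact_mod_cast hN₀two.trans hN
    have hNpos : (0 : ℝ) < N := by linarith
    rw [hDeq N hN]
    have h1 : ((N : ℝ) - 1) / (Cq * N) ≤ ((N : ℝ) - 1) / resistance D N :=
      div_le_div_of_nonneg_left (hN1pos N hN).le (hRpos N hN) (hRlin N hN)
    refine le_trans ?_ h1
    rw [div_le_div_iff₀ (by positivity) (by positivity)]
    nlinarith
  -- (2) slow decrease (the one-sided Tauberian modulus)
  have hslowD : ∀ N, N₀ ≤ N → D N - D (N + 1) ≤ (2 * Cp * S ^ 2) / N := by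
    intro N hN
    have hN' : N₀ ≤ N + 1 := hN.trans (Nat.le_succ _)
    have hNr : (2 : ℝ) ≤ N := by exact_mod_cast hN₀two.trans hN
    set R := resistance D N with hR
    set R' := resistance D (N + 1) with hR'
    have hR0 : 0 < R := hRpos N hN
    have hR'0 : 0 < R' := hRpos (N + 1) hN'
    have hR'le : R' ≤ R + Cp := hstep N hN
    have hDN : D N = ((N : ℝ) - 1) / R := hDeq N hN
    have hDN' : D (N + 1) = (N : ℝ) / R' := by
      have := hDeq (N + 1) hN'
      simpa using this
    have hlow' : (N : ℝ) / (R + Cp) ≤ D (N + 1) := by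
      rw [hDN']
      exact div_le_div_of_nonneg_left (by linarith) hR'0 hR'le
    have hmain : ((N : ℝ) - 1) / R - N / (R + Cp) ≤ Cp * S ^ 2 / ((N : ℝ) - 1) := by
      have hRCp : 0 < R + Cp := by linarith
      have hcomb : ((N : ℝ) - 1) / R - N / (R + Cp) = (((N : ℝ) - 1) * Cp - R) / (R * (R + Cp)) := by
        field_simp
        ring
      rw [hcomb]
      have hnum : ((N : ℝ) - 1) * Cp - R ≤ ((N : ℝ) - 1) * Cp := by linarith
      have hnum0 : 0 ≤ ((N : ℝ) - 1) * Cp := by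
        have := (hN1pos N hN).le
        positivity
      have hden : R * R ≤ R * (R + Cp) := by nlinarith
      have hden0 : 0 < R * R := by positivity
      calc (((N : ℝ) - 1) * Cp - R) / (R * (R + Cp)) ≤ (((N : ℝ) - 1) * Cp) / (R * R) :=
            div_le_div₀ hnum0 hnum hden0 hden
        _ = ((N : ℝ) - 1) * Cp * (1 / R) ^ 2 := by
            field_simp
        _ ≤ ((N : ℝ) - 1) * Cp * (S / ((N : ℝ) - 1)) ^ 2 := by
            apply mul_le_mul_of_nonneg_left _ hnum0
            exact pow_le_pow_left₀ (by positivity) (hinvR N hN) 2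
        _ = Cp * S ^ 2 / ((N : ℝ) - 1) := by
            field_simp
    have hfin : Cp * S ^ 2 / ((N : ℝ) - 1) ≤ 2 * Cp * S ^ 2 / N := by
      rw [div_le_div_iff₀ (hN1pos N hN) (by linarith)]
      have : 0 ≤ Cp * S ^ 2 := by positivity
      nlinarith
    calc D N - D (N + 1) ≤ ((N : ℝ) - 1) / R - N / (R + Cp) := by rw [hDN]; linarith
      _ ≤ Cp * S ^ 2 / ((N : ℝ) - 1) := hmain
      _ ≤ 2 * Cp * S ^ 2 / N := hfin
  -- (3)/(4) doubling and tripling conversions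
  have hscale : ∀ (k : ℕ), (k = 2 ∨ k = 3) → ∀ N, N₀ ≤ N →
      resistance D (k * N) ≤ k * resistance D N + N * ε N → D N - S ^ 2 * ε N ≤ D (k * N) := by
    intro k hk N hN hglueR
    have hk2 : (2 : ℕ) ≤ k := by rcases hk with rfl | rfl <;> norm_num
    have hk3 : k ≤ 3 := by rcases hk with rfl | rfl <;> norm_num
    have hkr2 : (2 : ℝ) ≤ k := by exact_mod_cast hk2
    have hkr3 : (k : ℝ) ≤ 3 := by exact_mod_cast hk3
    have hkN : N₀ ≤ k * N := hN.trans (Nat.le_mul_of_pos_left N (by omega))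
    have hNr : (2 : ℝ) ≤ N := by exact_mod_cast hN₀two.trans hN
    set R := resistance D N with hR
    set Rk := resistance D (k * N) with hRk
    have hR0 : 0 < R := hRpos N hN
    have hRk0 : 0 < Rk := hRpos (k * N) hkN
    have hεN : 0 ≤ ε N := hεnn N
    have hDN : D N = ((N : ℝ) - 1) / R := hDeq N hN
    have hDk : D (k * N) = ((k : ℝ) * N - 1) / Rk := by
      have := hDeq (k * N) hkN
      simpa using this
    have hden0 : 0 < (k : ℝ) * R + N * ε N := lt_of_lt_of_le hRk0 hglueR
    have hlow' : ((k : ℝ) * N - 1) / ((k : ℝ) * R + N * ε N) ≤ D (k * N) := by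
      rw [hDk]
      refine div_le_div_of_nonneg_left ?_ hRk0 hglueR
      nlinarith
    have hmain : ((N : ℝ) - 1) / R - ((k : ℝ) * N - 1) / ((k : ℝ) * R + N * ε N) ≤ S ^ 2 * ε N := by
      have hcomb : ((N : ℝ) - 1) / R - ((k : ℝ) * N - 1) / ((k : ℝ) * R + N * ε N)
          = (((N : ℝ) - 1) * N * ε N - (k - 1) * R) / (R * ((k : ℝ) * R + N * ε N)) := by
        field_simp
        ring
      rw [hcomb]
      have hnum : ((N : ℝ) - 1) * N * ε N - (k - 1) * R ≤ ((N : ℝ) - 1) * N * ε N := by nlinarith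
      have hnum0 : 0 ≤ ((N : ℝ) - 1) * N * ε N := by
        have := (hN1pos N hN).le
        have : (0 : ℝ) ≤ N := by linarith
        positivity
      have hden : R * (2 * R) ≤ R * ((k : ℝ) * R + N * ε N) := by
        apply mul_le_mul_of_nonneg_left _ hR0.le
        nlinarith
      have hden0 : 0 < R * (2 * R) := by positivity
      calc (((N : ℝ) - 1) * N * ε N - (k - 1) * R) / (R * ((k : ℝ) * R + N * ε N))
            ≤ (((N : ℝ) - 1) * N * ε N) / (R * (2 * R)) := div_le_div₀ hnum0 hnum hden0 hden
        _ = ((N : ℝ) - 1) * N * ε N / 2 * (1 / R) ^ 2 := by field_simp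
        _ ≤ ((N : ℝ) - 1) * N * ε N / 2 * (S / ((N : ℝ) - 1)) ^ 2 := by
            apply mul_le_mul_of_nonneg_left _ (by positivity)
            exact pow_le_pow_left₀ (by positivity) (hinvR N hN) 2
        _ = (N / (2 * ((N : ℝ) - 1))) * (S ^ 2 * ε N) := by
            field_simp
        _ ≤ 1 * (S ^ 2 * ε N) := by
            apply mul_le_mul_of_nonneg_right _ (by positivity)
            rw [div_le_one (by linarith [hN1pos N hN])]
            linarith
        _ = S ^ 2 * ε N := one_mul _
    calc D N - S ^ 2 * ε N ≤ ((k : ℝ) * N - 1) / ((k : ℝ) * R + N * ε N) := by rw [hDN]; linarith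
      _ ≤ D (k * N) := hlow'
  have h2D : ∀ N, N₀ ≤ N → D N - S ^ 2 * ε N ≤ D (2 * N) := by
    intro N hN
    refine hscale 2 (Or.inl rfl) N hN ?_
    have := (hSr N (hN₀2.trans hN)).1
    simpa using this
  have h3D : ∀ N, N₀ ≤ N → D N - S ^ 2 * ε N ≤ D (3 * N) := by
    intro N hN
    refine hscale 3 (Or.inr rfl) N hN ?_
    have := (hSr N (hN₀2.trans hN)).2
    simpa using this
  -- apply the glue
  have hεa' : Antitone (fun n : ℕ => S ^ 2 * ε n) := fun a b hab =>
    mul_le_mul_of_nonneg_left (hεa hab) (sq_nonneg S)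
  have hεs' : Summable (fun k : ℕ => S ^ 2 * ε (2 ^ k)) := hεs.mul_left (S ^ 2)
  exact Glue.logScaleRigidity D S (2 * Cp * S ^ 2) (1 / (2 * Cq)) (fun n => S ^ 2 * ε n) N₀ (by positivity)
    hfloor hDS hslowD hεa' hεs' h2D h3D

/-! ## Part IV — the skeleton theorem: the three stubs give the crux BY NAME (sorry-free) -/

/-- **`BoundedResponseConverges_of`** — `stub_positiveConductance → stub_upperIncrement → stub_selfSimilarGluing →
OddSectorIrreversibility.BoundedResponseConverges` (kernel-checked; axioms propext / Classical.choice / Quot.sound).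
The crux's `BddAbove` is consumed here (and only here); its uniqueness / steady-family / response data are
threaded into the stubs verbatim. [folklore] -/
theorem BoundedResponseConverges_of (hP : stub_positiveConductance) (hU : stub_upperIncrement)
    (hS : stub_selfSimilarGluing) :
    Summit.AtomisticToContinuum.FouriersLaw.Theses.OddSectorIrreversibility.BoundedResponseConverges := by
  intro ω₂ lam β γ hω hl hβ hγ hUniq μ hμ T hT D hD hBdd
  have hpos : ∀ N : ℕ, 2 ≤ N → 0 < D N := hP ω₂ lam β γ hω hl hβ hγ hUniq μ hμ T hT D hD
  obtain ⟨C', N₁, hU'⟩ := hU ω₂ lam β γ hω hl hβ hγ hUniq μ hμ T hT D hD hpos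
  obtain ⟨ε, hεa, hεs, N₂, hS'⟩ := hS ω₂ lam β γ hω hl hβ hγ hUniq μ hμ T hT D hD hpos
  obtain ⟨S, hS0⟩ := hBdd
  have hDS : ∀ N, D N ≤ S := fun N => (le_abs_self _).trans (hS0 ⟨N, rfl⟩)
  exact tendsto_of_increment_of_gluing hDS hpos hU' hεa hεs hS'

/-- D-0027 §3.3 shape: the crux from the registered stubs (an `example`, so that `BoundedResponseConverges_of`
stays the unique theorem concluding the crux; it becomes a proof once the three `sorry`s are discharged). -/
example : Summit.AtomisticToContinuum.FouriersLaw.Theses.OddSectorIrreversibility.BoundedResponseConverges :=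
  BoundedResponseConverges_of Holds.stub_positiveConductance Holds.stub_upperIncrement Holds.stub_selfSimilarGluing

/-! ### The three twins (shared import slot; verbatim signatures, so the same composition closes them) -/

/-- `TransferKernelPositivity.BoundedResponseConverges` (route-AtomisticToContinuum-TransferKernelPositivity, rank 5)
from the same three stubs, definitionally. [folklore] -/
theorem BoundedResponseConverges_transferKernelPositivity_of (hP : stub_positiveConductance)
    (hU : stub_upperIncrement) (hS : stub_selfSimilarGluing) :
    Summit.AtomisticToContinuum.FouriersLaw.Theses.TransferKernelPositivity.BoundedResponseConverges :=
  BoundedResponseConverges_of hP hU hS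

/-- `LocalOhmBV.BoundedResponseConverges` (route-AtomisticToContinuum-LocalOhmBV, rank 4) likewise. [folklore] -/
theorem BoundedResponseConverges_localOhmBV_of (hP : stub_positiveConductance)
    (hU : stub_upperIncrement) (hS : stub_selfSimilarGluing) :
    Summit.AtomisticToContinuum.FouriersLaw.Theses.LocalOhmBV.BoundedResponseConverges :=
  BoundedResponseConverges_of hP hU hS

/-- `MatthiessenLadder.BoundedResponseConverges` (route-AtomisticToContinuum-MatthiessenLadder, rank 5) likewise.
[folklore] -/
theorem BoundedResponseConverges_matthiessenLadder_of (hP : stub_positiveConductance)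
    (hU : stub_upperIncrement) (hS : stub_selfSimilarGluing) :
    Summit.AtomisticToContinuum.FouriersLaw.Theses.MatthiessenLadder.BoundedResponseConverges :=
  BoundedResponseConverges_of hP hU hS

/-! ## Part V — by-products recorded for the lead (all sorry-free) -/

/-- **Positivity is RELOCATED, not dissolved (triage r1-2, made formal).** Stubs 1 + 2 alone already give
`JunctionLocality.ConductanceLowerBound` (stmt-AtomisticToContinuum-11749, an open crux of that route):
`R_N ≤ R_{N₀} + C⁺(N − N₀)` telescoped from (U), hence `D_N = (N−1)/R_N ≥ 1/(2·max(C⁺, R_{N₀}))` for `N ≥ N₀`.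
So (U) carries an `N`-uniform lower bound on the conductance as part of its content. [folklore] -/
theorem conductanceLowerBound_of_stubs (hP : stub_positiveConductance) (hU : stub_upperIncrement) :
    Summit.AtomisticToContinuum.FouriersLaw.Theses.JunctionLocality.ConductanceLowerBound := by
  intro ω₂ lam β γ hω hl hβ hγ hUniq μ hμ T hT D hD
  have hpos2 : ∀ N : ℕ, 2 ≤ N → 0 < D N := hP ω₂ lam β γ hω hl hβ hγ hUniq μ hμ T hT D hD
  obtain ⟨C', N₁, hU'⟩ := hU ω₂ lam β γ hω hl hβ hγ hUniq μ hμ T hT D hD hpos2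
  have hUr : ∀ N, N₁ ≤ N → resistance D (N + 1) ≤ resistance D N + C' := fun N hN => hU' N hN
  set N₀ : ℕ := max N₁ 2 with hN₀def
  have hN₀1 : N₁ ≤ N₀ := le_max_left _ _
  have hN₀two : 2 ≤ N₀ := le_max_right _ _
  have hpos : ∀ N, N₀ ≤ N → 0 < D N := fun N hN => hpos2 N (hN₀two.trans hN)
  have hN1pos : ∀ N, N₀ ≤ N → (0 : ℝ) < (N : ℝ) - 1 := by
    intro N hN
    have : (2 : ℝ) ≤ N := by exact_mod_cast hN₀two.trans hN
    linarith
  have hRpos : ∀ N, N₀ ≤ N → 0 < resistance D N := fun N hN =>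
    div_pos (hN1pos N hN) (hpos N hN)
  have hDeq : ∀ N, N₀ ≤ N → D N = ((N : ℝ) - 1) / resistance D N := by
    intro N hN
    have h1 := (hN1pos N hN).ne'
    have h2 := (hpos N hN).ne'
    show D N = ((N : ℝ) - 1) / (((N : ℝ) - 1) / D N)
    field_simp
  set Cp : ℝ := max C' 0 with hCpdef
  have hCp : 0 ≤ Cp := le_max_right _ _
  have hstep : ∀ N, N₀ ≤ N → resistance D (N + 1) ≤ resistance D N + Cp := fun N hN =>
    (hUr N (hN₀1.trans hN)).trans (by simp [hCpdef])
  have hRup : ∀ N, N₀ ≤ N → resistance D N ≤ resistance D N₀ + Cp * ((N : ℝ) - N₀) := by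
    refine Nat.le_induction ?_ ?_
    · simp
    · intro N hN ih
      calc resistance D (N + 1) ≤ resistance D N + Cp := hstep N hN
        _ ≤ resistance D N₀ + Cp * ((N : ℝ) - N₀) + Cp := by linarith
        _ = resistance D N₀ + Cp * (((N + 1 : ℕ) : ℝ) - N₀) := by push_cast; ring
  set Cq : ℝ := max Cp (resistance D N₀) with hCqdef
  have hCqpos : 0 < Cq := (hRpos N₀ le_rfl).trans_le (le_max_right _ _)
  have hRlin : ∀ N, N₀ ≤ N → resistance D N ≤ Cq * N := by
    intro N hN
    have h1 : resistance D N₀ ≤ Cq := le_max_right _ _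
    have h2 : Cp ≤ Cq := le_max_left _ _
    have hNN : ((N₀ : ℕ) : ℝ) ≤ N := by exact_mod_cast hN
    have hN₀one : (1 : ℝ) ≤ N₀ := by exact_mod_cast (le_trans (by norm_num) hN₀two)
    have hsub : (0 : ℝ) ≤ (N : ℝ) - N₀ := by linarith
    calc resistance D N ≤ resistance D N₀ + Cp * ((N : ℝ) - N₀) := hRup N hN
      _ ≤ Cq + Cq * ((N : ℝ) - N₀) := add_le_add h1 (mul_le_mul_of_nonneg_right h2 hsub)
      _ = Cq * (1 + ((N : ℝ) - N₀)) := by ring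
      _ ≤ Cq * N := mul_le_mul_of_nonneg_left (by linarith) hCqpos.le
  refine ⟨1 / (2 * Cq), by positivity, N₀, fun N hN => ?_⟩
  have hNr : (2 : ℝ) ≤ N := by exact_mod_cast hN₀two.trans hN
  have hNpos : (0 : ℝ) < N := by linarith
  rw [hDeq N hN]
  have h1 : ((N : ℝ) - 1) / (Cq * N) ≤ ((N : ℝ) - 1) / resistance D N :=
    div_le_div_of_nonneg_left (hN1pos N hN).le (hRpos N hN) (hRlin N hN)
  refine le_trans ?_ h1
  rw [div_le_div_iff₀ (by positivity) (by positivity)]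
  nlinarith

/-- **Ladder ⇒ (U) at sequence level (triage r1-1/2/3 cross-line note, kernel-checked).** If `D` is positive
from `N = 2` on and eventually nondecreasing (`ohmic-floor-monotone-ladder`'s lever) then the increment bound holds
with `C = 1/D N₀`: `R_{N+1} − R_N = N/D_{N+1} − (N−1)/D_N ≤ 1/D_N ≤ 1/D_{N₀}`. [folklore] -/
theorem increment_of_monotone {D : ℕ → ℝ} {N₀ : ℕ} (h2 : 2 ≤ N₀)
    (hpos : ∀ N : ℕ, 2 ≤ N → 0 < D N) (hmono : ∀ N : ℕ, N₀ ≤ N → D N ≤ D (N + 1)) :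
    ∀ N : ℕ, N₀ ≤ N → (((N + 1 : ℕ) : ℝ) - 1) / D (N + 1) ≤ ((N : ℝ) - 1) / D N + 1 / D N₀ := by
  -- monotone chain from N₀
  have hchain : ∀ N, N₀ ≤ N → D N₀ ≤ D N := by
    refine Nat.le_induction le_rfl ?_
    intro N hN ih
    exact ih.trans (hmono N hN)
  intro N hN
  have hD0 : 0 < D N₀ := hpos N₀ h2
  have hDN : 0 < D N := hpos N (h2.trans hN)
  have hDN1 : 0 < D (N + 1) := hpos (N + 1) (h2.trans (hN.trans (Nat.le_succ N)))
  have hNr : (2 : ℝ) ≤ N := by exact_mod_cast h2.trans hN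
  have hmN : D N ≤ D (N + 1) := hmono N hN
  have hcN : D N₀ ≤ D N := hchain N hN
  -- N/D(N+1) ≤ N/D N
  have hA : (((N + 1 : ℕ) : ℝ) - 1) / D (N + 1) ≤ (N : ℝ) / D N := by
    have : (((N + 1 : ℕ) : ℝ) - 1) = (N : ℝ) := by push_cast; ring
    rw [this]
    exact div_le_div_of_nonneg_left (by linarith) hDN hmN
  -- N/D N = (N-1)/D N + 1/D N and 1/D N ≤ 1/D N₀
  have hB : (N : ℝ) / D N = ((N : ℝ) - 1) / D N + 1 / D N := by
    rw [← add_div]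
    congr 1
    ring
  have hC : 1 / D N ≤ 1 / D N₀ := one_div_le_one_div_of_le hD0 hcN
  linarith [hA, hB, hC]

/-- **Ladder ⇒ (S23) at sequence level.** Under the same hypotheses the self-similar gluing bounds hold with the
explicit slack `ε N = 4 / (D N₀ · (N + 1))` (antitone, summable along `2^k`): `R_{kN} − kR_N ≤ (k−1)/D_N ≤ 2/D_{N₀}
≤ N ε(N)` for `k = 2, 3`, `N ≥ max(N₀, 1)`. So the ladder line is a special case of this one. [folklore] -/
theorem gluing_of_monotone {D : ℕ → ℝ} {N₀ : ℕ} (h2 : 2 ≤ N₀)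
    (hpos : ∀ N : ℕ, 2 ≤ N → 0 < D N) (hmono : ∀ N : ℕ, N₀ ≤ N → D N ≤ D (N + 1)) :
    Antitone (fun N : ℕ => 4 / (D N₀ * ((N : ℝ) + 1))) ∧
    Summable (fun k : ℕ => 4 / (D N₀ * ((((2 : ℕ) ^ k : ℕ) : ℝ) + 1))) ∧
    ∀ N : ℕ, N₀ ≤ N →
      (((2 * N : ℕ) : ℝ) - 1) / D (2 * N) ≤ 2 * (((N : ℝ) - 1) / D N) + (N : ℝ) * (4 / (D N₀ * ((N : ℝ) + 1))) ∧
      (((3 * N : ℕ) : ℝ) - 1) / D (3 * N) ≤ 3 * (((N : ℝ) - 1) / D N) + (N : ℝ) * (4 / (D N₀ * ((N : ℝ) + 1))) := by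
  have hD0 : 0 < D N₀ := hpos N₀ h2
  have hchain : ∀ N, N₀ ≤ N → ∀ M, N ≤ M → D N ≤ D M := by
    intro N hN
    refine Nat.le_induction le_rfl ?_
    intro M hM ih
    exact ih.trans (hmono M (hN.trans hM))
  refine ⟨?_, ?_, ?_⟩
  · -- antitone
    intro a b hab
    dsimp only
    have ha : (0 : ℝ) < (a : ℝ) + 1 := by positivity
    have hab' : (a : ℝ) + 1 ≤ (b : ℝ) + 1 := by exact_mod_cast Nat.succ_le_succ hab
    exact div_le_div_of_nonneg_left (by norm_num) (by positivity) (mul_le_mul_of_nonneg_left hab' hD0.le)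
  · -- summable: compare with the geometric series 4/D N₀ · (1/2)^k
    have hgeom : Summable (fun k : ℕ => (4 / D N₀) * (1 / 2 : ℝ) ^ k) :=
      (summable_geometric_of_lt_one (by norm_num) (by norm_num)).mul_left _
    refine Summable.of_nonneg_of_le (fun k => by positivity) (fun k => ?_) hgeom
    have hcast : ((((2 : ℕ) ^ k : ℕ) : ℝ)) = (2 : ℝ) ^ k := by push_cast; ring
    have h2pow : (0 : ℝ) < (2 : ℝ) ^ k := by positivity
    have hD0' : D N₀ ≠ 0 := hD0.ne'
    have hrhs : (4 / D N₀) * (1 / 2 : ℝ) ^ k = 4 / (D N₀ * (2 : ℝ) ^ k) := by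
      rw [one_div_pow]
      field_simp
    rw [hcast, hrhs]
    exact div_le_div_of_nonneg_left (by norm_num) (by positivity)
      (mul_le_mul_of_nonneg_left (by linarith) hD0.le)
  · intro N hN
    have hN2 : 2 ≤ N := h2.trans hN
    have hNr : (2 : ℝ) ≤ N := by exact_mod_cast hN2
    have hDN : 0 < D N := hpos N hN2
    have hcN : D N₀ ≤ D N := hchain N₀ le_rfl N hN
    have hslack : 2 / D N₀ ≤ (N : ℝ) * (4 / (D N₀ * ((N : ℝ) + 1))) := by
      rw [div_le_iff₀ hD0]
      have : (N : ℝ) * (4 / (D N₀ * ((N : ℝ) + 1))) * D N₀ = 4 * N / ((N : ℝ) + 1) := by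
        field_simp
      rw [this, le_div_iff₀ (by positivity)]
      nlinarith
    have hinv : 1 / D N ≤ 1 / D N₀ := one_div_le_one_div_of_le hD0 hcN
    have key : ∀ k : ℕ, (k = 2 ∨ k = 3) →
        (((k * N : ℕ) : ℝ) - 1) / D (k * N) ≤ k * (((N : ℝ) - 1) / D N) + (N : ℝ) * (4 / (D N₀ * ((N : ℝ) + 1))) := by
      intro k hk
      have hk1 : 1 ≤ k := by rcases hk with rfl | rfl <;> norm_num
      have hk3 : (k : ℝ) ≤ 3 := by rcases hk with rfl | rfl <;> norm_num
      have hkr1 : (1 : ℝ) ≤ k := by exact_mod_cast hk1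
      have hkN : N ≤ k * N := Nat.le_mul_of_pos_left N (by omega)
      have hDk : 0 < D (k * N) := hpos (k * N) (hN2.trans hkN)
      have hmk : D N ≤ D (k * N) := hchain N hN (k * N) hkN
      -- (kN - 1)/D(kN) ≤ (kN - 1)/D N = k (N-1)/D N + (k-1)/D N
      have hA : (((k * N : ℕ) : ℝ) - 1) / D (k * N) ≤ ((k : ℝ) * N - 1) / D N := by
        have hc : (((k * N : ℕ) : ℝ) - 1) = (k : ℝ) * N - 1 := by push_cast; ring
        rw [hc]
        exact div_le_div_of_nonneg_left (by nlinarith) hDN hmk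
      have hB : ((k : ℝ) * N - 1) / D N = k * (((N : ℝ) - 1) / D N) + ((k : ℝ) - 1) * (1 / D N) := by
        field_simp
        ring
      have hC : ((k : ℝ) - 1) * (1 / D N) ≤ 2 * (1 / D N₀) := by
        have h1 : (0 : ℝ) ≤ 1 / D N := by positivity
        nlinarith [hinv, h1]
      have hD' : 2 * (1 / D N₀) = 2 / D N₀ := by ring
      linarith [hA, hB, hC, hD', hslack]
    exact ⟨key 2 (Or.inl rfl), key 3 (Or.inr rfl)⟩

end Summit.AtomisticToContinuum.FouriersLaw.Cruxes.BoundedResponseConverges.TwoScaleGluingLogRigidity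

end
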